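/-
Copyright (c) 2026 the pub-hodgecm-mathlib formalisation cell (harness21).  Prover seat hodgecm-mathlib-B-p10 (g27), 2026-09-01.  Road «S3-tree», generic organ for brick T3
(executor's LAW SHEET `T0-LAWS.md` §L3, the LEVEL-SHIFT LAW's mechanism): level-`j` fixed cosets of `GL_n(F) ⧸ GL_n(𝒪)` are the lattices stable under the SHIFTED endomorphism.
-/
import Literature.NumberTheory.Automorphic.FixedCosetsStableLattices   -- ★ the `j = 0` dictionary: `Λ(g) = span 𝒪 (range gᵀ)`, `span_range_transpose_mul`, `span_range_transpose_le_one_iff`, `map_span_range_transpose_eq_self_iff`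
import Literature.NumberTheory.Automorphic.HeckeTransversalGL          -- ★ `IsIntegralMatrix`, `mem_glInt_of_isIntegralMatrix`, `valuation_det_eq_one_of_mem_glInt`
import Mathlib.RingTheory.LocalRing.ResidueField.Basic
import HarnessLib

/-!
# Level-`j` fixed cosets are shift-stable lattices (the mechanism of the LEVEL-SHIFT LAW `N_j(γ) = N_0(γ^{(−j)})`)

Topic `NumberTheory/Automorphic`; namespace `Literature.NumberTheory.Automorphic` (the currency of ★ `FixedCosetsStableLattices`: `[Field F] [ValuativeRel F]`, `𝒪 = 𝒪[F]`,
`K = glInt n F = GL_n(𝒪)`, `Λ(g) = Submodule.span 𝒪[F] (Set.range (↑g)ᵀ)`).  THEOREMS ONLY (no definition, no instance, no notation, no named fact, no `sorry`); any `n`,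
any valued field; zero `U(2,1)`-specific content.  Cell `pub/hodgecm-mathlib`, crux H413 = `stmt-HodgeConjecture-24833`; road «S3-tree» (census «S3» v2∕v3, architect A-p16 (g28)),
brick T3 «class values for `1_{K(j) g K(j)}` via the sphere counts `C_k` + the LEVEL-SHIFT LAW»; numerical certificate S3-T0 GREEN (executor F0P3b-p01 (g10), law sheet
`F0/P3/F0P3b-p01/g10/T0/T0-LAWS.md` §L3: «`N_j(γ) = N_0(γ^{(−j)})` … mechanism `{L : γL = L, (γ−1)L ⊆ p^jL} = {L : 𝒪_E[(γ−1)∕p^j]·L ⊆ L}`», 372∕372 + 92∕92 cells, three codes).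
Seat B-p10 (g27).  HONEST LABEL: HC_CM is proved only modulo the cell's 2 remaining named inputs (hLiu418, h413) until rung 0 closes; nothing printed is asserted here —
this is linear algebra over a valuation ring.

THE MATHEMATICS.  Fix `c ∈ F` with `0 < |c| < 1` (think `c = ϖ^j`, `j ≥ 1`) and `γ ∈ GL_n(F)`.  The SHIFTED matrix is `γ^{(c)} := 1 + c⁻¹(γ − 1) ∈ M_n(F)` (not invertible in
general).  For a coset `gK`, `K = GL_n(𝒪)`: «`γ` fixes `gK` at level `c`» means `g⁻¹γg ∈ K` and `g⁻¹γg ≡ 1 (mod c)`, i.e. `γ·Λ(g) = Λ(g)` and `(γ − 1)Λ(g) ⊆ c·Λ(g)`.  Since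
`g⁻¹ γ^{(c)} g = 1 + c⁻¹(g⁻¹γg − 1)` (§1), the level-`c` condition says exactly that `g⁻¹γ^{(c)}g` is INTEGRAL, i.e. `γ^{(c)}·Λ(g) ⊆ Λ(g)` (§3) — and the condition `g⁻¹γg ∈ K`
comes for free: a matrix `≡ 1 (mod 𝔪)` entrywise has `det ≡ 1 (mod 𝔪)`, a unit (§2).  Hence `#{gK : γ·gK = gK at level c} = #{Λ in the class of 𝒪ⁿ : γ^{(c)} Λ ⊆ Λ}`: the
level-`j` count of `γ` is a level-`0`-type count of the shifted element, whose eigenvalue differences are those of `γ` divided by `c` (road T3 reads the right side off the tree).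

* §1 `inv_mul_levelShift_mul` — `↑g⁻¹ * (1 + c⁻¹ • (↑γ − 1)) * ↑g = 1 + c⁻¹ • (↑(g⁻¹ γ g) − 1)`.
* §2 `valuation_det_eq_one_of_forall_valuation_sub_one_lt_one`, `mem_glInt_of_forall_valuation_sub_one_lt_one` — `M ≡ 1 (mod 𝔪)` entrywise ⇒ `|det M| = 1` ⇒ `M ∈ GL_n(𝒪)`.
* §3 `mem_glInt_and_level_iff_isIntegralMatrix_levelShift` (matrix form) and `mem_glInt_and_level_iff_map_levelShift_le` (lattice form: `… ↔ (Λ g).map γ^{(c)} ≤ Λ g`),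
  `map_eq_self_and_level_iff_map_levelShift_le` (both sides in lattice language).

## References
* [Kottwitz1986] R. E. Kottwitz, *Base change for unit elements of Hecke algebras*, Compositio Math. 60 (1986): §3 (fixed cosets ↔ stable lattices).
* [Laumon1995] G. Laumon, *Cohomology of Drinfeld Modular Varieties* I (1996): (4.3.11) p. 83, Lemma (5.3.2) p. 136.
* [Serre1980Trees] J.-P. Serre, *Trees* (1980): Ch. II §1.1–1.2 (lattices, the tree of `SL₂`; distance and the congruence level of a stabiliser).
-/

set_option autoImplicit false

noncomputable section

open scoped ValuativeRel Matrix MatrixGroups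
open Matrix ValuativeRel

namespace Literature.NumberTheory.Automorphic

variable {F : Type*} [Field F] [ValuativeRel F] {n : ℕ}

/-! ## §1 Conjugating the shifted matrix -/

omit [ValuativeRel F] in
/-- **`g⁻¹ γ^{(c)} g = (g⁻¹γg)^{(c)}`**: `↑g⁻¹ * (1 + c⁻¹ • (↑γ − 1)) * ↑g = 1 + c⁻¹ • (↑(g⁻¹ γ g) − 1)`. [cite: Serre1980Trees, Ch. II §1.1–1.2] -/
theorem inv_mul_levelShift_mul (c : F) (γ g : GL (Fin n) F) :
    ((g⁻¹ : GL (Fin n) F) : Matrix (Fin n) (Fin n) F) * (1 + c⁻¹ • ((γ : Matrix (Fin n) (Fin n) F) - 1)) * (g : Matrix (Fin n) (Fin n) F) =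
      1 + c⁻¹ • (((g⁻¹ * γ * g : GL (Fin n) F) : Matrix (Fin n) (Fin n) F) - 1) := by
  have hg : ((g⁻¹ : GL (Fin n) F) : Matrix (Fin n) (Fin n) F) * (g : Matrix (Fin n) (Fin n) F) = 1 := by
    rw [← Units.val_mul, inv_mul_cancel, Units.val_one]
  rw [Units.val_mul, Units.val_mul, Matrix.mul_add, Matrix.add_mul, Matrix.mul_one, hg, Matrix.mul_smul, Matrix.smul_mul, Matrix.mul_sub,
    Matrix.sub_mul, Matrix.mul_one, hg]

omit [ValuativeRel F] in
/-- Entries of the conjugated shift: `(g⁻¹ γ^{(c)} g)_{ik} = δ_{ik} + c⁻¹ (↑(g⁻¹γg) − 1)_{ik}`. [cite: Serre1980Trees, Ch. II §1.1–1.2] -/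
theorem inv_mul_levelShift_mul_apply (c : F) (γ g : GL (Fin n) F) (i k : Fin n) :
    (((g⁻¹ : GL (Fin n) F) : Matrix (Fin n) (Fin n) F) * (1 + c⁻¹ • ((γ : Matrix (Fin n) (Fin n) F) - 1)) * (g : Matrix (Fin n) (Fin n) F)) i k =
      (1 : Matrix (Fin n) (Fin n) F) i k + c⁻¹ * (((g⁻¹ * γ * g : GL (Fin n) F) : Matrix (Fin n) (Fin n) F) - 1) i k := by
  rw [inv_mul_levelShift_mul, Matrix.add_apply, Matrix.smul_apply, smul_eq_mul]

/-! ## §2 A matrix congruent to `1` modulo the maximal ideal lies in `GL_n(𝒪)` -/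

/-- **`M ≡ 1 (mod 𝔪)` entrywise ⇒ `|det M| = 1`**: if every entry of `M − 1` has valuation `< 1`, the determinant of `M` is a unit of `𝒪` (its residue is `det 1 = 1`).
[cite: Serre1980Trees, Ch. II §1.1–1.2] -/
theorem valuation_det_eq_one_of_forall_valuation_sub_one_lt_one (M : Matrix (Fin n) (Fin n) F) (hM : ∀ i k, valuation F ((M - 1) i k) < 1) :
    valuation F M.det = 1 := by
  -- lift `M − 1` to a matrix `A` over `𝒪` with entries in the maximal ideal
  set A : Matrix (Fin n) (Fin n) 𝒪[F] := fun i k => ⟨(M - 1) i k, (Valuation.mem_integer_iff _ _).2 (hM i k).le⟩ with hA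
  have hMA : M = (1 + A).map (𝒪[F]).subtype := by
    ext i k
    rw [Matrix.map_apply, Matrix.add_apply, Subring.subtype_apply, Subring.coe_add, hA]
    change M i k = ((1 : Matrix (Fin n) (Fin n) 𝒪[F]) i k : F) + (M - 1) i k
    rw [Matrix.sub_apply, Matrix.one_apply, Matrix.one_apply]
    split_ifs <;> simp
  have hres : IsLocalRing.residue 𝒪[F] (1 + A).det = 1 := by
    rw [RingHom.map_det, map_add, map_one]
    have hA0 : (IsLocalRing.residue 𝒪[F]).mapMatrix A = 0 := by
      ext i k
      rw [RingHom.mapMatrix_apply, Matrix.map_apply, Matrix.zero_apply, IsLocalRing.residue_eq_zero_iff, IsLocalRing.mem_maximalIdeal, mem_nonunits_iff,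
        Valuation.Integer.not_isUnit_iff_valuation_lt_one]
      exact hM i k
    rw [hA0, add_zero, Matrix.det_one]
  have hunit : IsUnit (1 + A).det := (IsLocalRing.residue_ne_zero_iff_isUnit _).1 (by rw [hres]; exact one_ne_zero)
  rw [hMA, ← RingHom.mapMatrix_apply, ← RingHom.map_det]
  exact Valuation.Integers.one_of_isUnit (Valuation.integer.integers (valuation F)) hunit

/-- **`M ≡ 1 (mod 𝔪)` entrywise ⇒ `M ∈ GL_n(𝒪)`** (integral entries and unit determinant; the inverse is `det⁻¹ · adj`) — the half of the LEVEL-SHIFT LAW that says «`γL = L` is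
automatic once `(γ − 1)L ⊆ ϖL`». [cite: Serre1980Trees, Ch. II §1.1–1.2] [cite: Kottwitz1986, §3] -/
theorem mem_glInt_of_forall_valuation_sub_one_lt_one (M : GL (Fin n) F) (hM : ∀ i k, valuation F (((M : Matrix (Fin n) (Fin n) F) - 1) i k) < 1) :
    M ∈ glInt n F := by
  refine mem_glInt_of_isIntegralMatrix (fun i k => ?_) (valuation_det_eq_one_of_forall_valuation_sub_one_lt_one _ hM)
  have h : (M : Matrix (Fin n) (Fin n) F) i k = (1 : Matrix (Fin n) (Fin n) F) i k + ((M : Matrix (Fin n) (Fin n) F) - 1) i k := by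
    rw [Matrix.sub_apply, add_sub_cancel]
  rw [h]
  exact Subring.add_mem _ (IsIntegralMatrix.one i k) ((Valuation.mem_integer_iff _ _).2 (hM i k).le)

/-! ## §3 The dictionary: level-`c` fixed cosets ↔ shift-stable lattices -/

/-- Bookkeeping: `|c⁻¹ x| ≤ 1 ↔ |x| ≤ |c|` for `c ≠ 0`. [cite: Serre1980Trees, Ch. II §1.1–1.2] -/
theorem valuation_inv_mul_le_one_iff {c : F} (hc : c ≠ 0) (x : F) : valuation F (c⁻¹ * x) ≤ 1 ↔ valuation F x ≤ valuation F c := by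
  have hc' : valuation F c ≠ 0 := (Valuation.ne_zero_iff _).2 hc
  rw [map_mul, map_inv₀, ← div_eq_inv_mul, div_le_one₀ (zero_lt_iff.2 hc')]

/-- **LEVEL-`c` FIXED COSET ⟺ THE SHIFTED MATRIX IS INTEGRAL IN THE BASIS `g`** (matrix form of the LEVEL-SHIFT LAW's mechanism): for `0 < |c| < 1`,
`(g⁻¹γg ∈ GL_n(𝒪) ∧ |(g⁻¹γg − 1)_{ik}| ≤ |c| ∀ i k) ↔ g⁻¹ (1 + c⁻¹(γ − 1)) g` is an integral matrix. [cite: Kottwitz1986, §3] [cite: Serre1980Trees, Ch. II §1.1–1.2] -/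
theorem mem_glInt_and_level_iff_isIntegralMatrix_levelShift {c : F} (hc : c ≠ 0) (hc1 : valuation F c < 1) (γ g : GL (Fin n) F) :
    (g⁻¹ * γ * g ∈ glInt n F ∧ ∀ i k, valuation F ((((g⁻¹ * γ * g : GL (Fin n) F) : Matrix (Fin n) (Fin n) F) - 1) i k) ≤ valuation F c) ↔
      IsIntegralMatrix (((g⁻¹ : GL (Fin n) F) : Matrix (Fin n) (Fin n) F) * (1 + c⁻¹ • ((γ : Matrix (Fin n) (Fin n) F) - 1)) * (g : Matrix (Fin n) (Fin n) F)) := by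
  constructor
  · rintro ⟨-, hlev⟩ i k
    rw [inv_mul_levelShift_mul_apply]
    exact Subring.add_mem _ (IsIntegralMatrix.one i k) ((Valuation.mem_integer_iff _ _).2 ((valuation_inv_mul_le_one_iff hc _).2 (hlev i k)))
  · intro hint
    have hlev : ∀ i k, valuation F ((((g⁻¹ * γ * g : GL (Fin n) F) : Matrix (Fin n) (Fin n) F) - 1) i k) ≤ valuation F c := by
      intro i k
      have h := hint i k
      rw [inv_mul_levelShift_mul_apply] at h
      have h' : c⁻¹ * ((((g⁻¹ * γ * g : GL (Fin n) F) : Matrix (Fin n) (Fin n) F) - 1) i k) ∈ 𝒪[F] := by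
        have := Subring.sub_mem _ h (IsIntegralMatrix.one (F := F) i k)
        rwa [add_sub_cancel_left] at this
      exact (valuation_inv_mul_le_one_iff hc _).1 ((Valuation.mem_integer_iff _ _).1 h')
    exact ⟨mem_glInt_of_forall_valuation_sub_one_lt_one _ fun i k => (hlev i k).trans_lt hc1, hlev⟩

/-- **LEVEL-`c` FIXED COSET ⟺ SHIFT-STABLE LATTICE** (lattice form): for `0 < |c| < 1`,
`(g⁻¹γg ∈ GL_n(𝒪) ∧ g⁻¹γg ≡ 1 (mod c)) ↔ γ^{(c)}·Λ(g) ⊆ Λ(g)` with `γ^{(c)} = 1 + c⁻¹(γ − 1)` and `Λ(g)` the `𝒪`-span of the columns of `g`.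
This is the law sheet's `{L : γL = L, (γ−1)L ⊆ cL} = {L : 𝒪[(γ−1)∕c]·L ⊆ L}` for `L` in the class of `𝒪ⁿ`. [cite: Kottwitz1986, §3] [cite: Laumon1995, Lemma (5.3.2) p. 136] -/
theorem mem_glInt_and_level_iff_map_levelShift_le {c : F} (hc : c ≠ 0) (hc1 : valuation F c < 1) (γ g : GL (Fin n) F) :
    (g⁻¹ * γ * g ∈ glInt n F ∧ ∀ i k, valuation F ((((g⁻¹ * γ * g : GL (Fin n) F) : Matrix (Fin n) (Fin n) F) - 1) i k) ≤ valuation F c) ↔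
      (Submodule.span 𝒪[F] (Set.range ((g : Matrix (Fin n) (Fin n) F))ᵀ)).map
          ((Matrix.toLin' (1 + c⁻¹ • ((γ : Matrix (Fin n) (Fin n) F) - 1))).restrictScalars 𝒪[F]) ≤
        Submodule.span 𝒪[F] (Set.range ((g : Matrix (Fin n) (Fin n) F))ᵀ) := by
  rw [mem_glInt_and_level_iff_isIntegralMatrix_levelShift hc hc1, ← span_range_transpose_mul]
  -- `Λ(S g) ≤ Λ(g) ↔ Λ(g⁻¹ S g) ≤ Λ(1)` by transporting with `g⁻¹`
  have key : ∀ X : Matrix (Fin n) (Fin n) F,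
      Submodule.span 𝒪[F] (Set.range Xᵀ) ≤ Submodule.span 𝒪[F] (Set.range ((g : Matrix (Fin n) (Fin n) F))ᵀ) ↔
        IsIntegralMatrix (((g⁻¹ : GL (Fin n) F) : Matrix (Fin n) (Fin n) F) * X) := by
    intro X
    unfold IsIntegralMatrix
    rw [← span_range_transpose_le_one_iff (((g⁻¹ : GL (Fin n) F) : Matrix (Fin n) (Fin n) F) * X)]
    have e1 : Submodule.span 𝒪[F] (Set.range Xᵀ) =
        (Submodule.span 𝒪[F] (Set.range ((((g⁻¹ : GL (Fin n) F) : Matrix (Fin n) (Fin n) F)) * X)ᵀ)).map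
          ((Matrix.toLin' (g : Matrix (Fin n) (Fin n) F)).restrictScalars 𝒪[F]) := by
      rw [← span_range_transpose_mul, ← Matrix.mul_assoc, ← Units.val_mul, mul_inv_cancel, Units.val_one, Matrix.one_mul]
    have e2 : Submodule.span 𝒪[F] (Set.range ((g : Matrix (Fin n) (Fin n) F))ᵀ) =
        (Submodule.span 𝒪[F] (Set.range (1 : Matrix (Fin n) (Fin n) F)ᵀ)).map ((Matrix.toLin' (g : Matrix (Fin n) (Fin n) F)).restrictScalars 𝒪[F]) := by
      rw [← span_range_transpose_mul, Matrix.mul_one]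
    have hinj : Function.Injective ((Matrix.toLin' (g : Matrix (Fin n) (Fin n) F)).restrictScalars 𝒪[F]) := by
      intro v w hvw
      have h := congrArg (fun x => ((g⁻¹ : GL (Fin n) F) : Matrix (Fin n) (Fin n) F) *ᵥ x) hvw
      simpa only [LinearMap.coe_restrictScalars, Matrix.toLin'_apply, Matrix.mulVec_mulVec, ← Units.val_mul, inv_mul_cancel,
        Units.val_one, Matrix.one_mulVec] using h
    rw [e1, e2]
    exact Submodule.map_le_map_iff_of_injective hinj _ _
  rw [key, Matrix.mul_assoc]

/-- **THE LEVEL-SHIFT DICTIONARY IN LATTICE LANGUAGE**: for `0 < |c| < 1` and `Λ = Λ(g)`: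
`(γ·Λ = Λ ∧ g⁻¹γg ≡ 1 (mod c)) ↔ γ^{(c)}·Λ ⊆ Λ` — the level-`c` fixed lattices of `γ` are the lattices mapped into themselves by the shifted endomorphism `1 + c⁻¹(γ − 1)`.
[cite: Kottwitz1986, §3] [cite: Laumon1995, Lemma (5.3.2) p. 136] [cite: Serre1980Trees, Ch. II §1.1–1.2] -/
theorem map_eq_self_and_level_iff_map_levelShift_le {c : F} (hc : c ≠ 0) (hc1 : valuation F c < 1) (γ g : GL (Fin n) F) :
    ((Submodule.span 𝒪[F] (Set.range ((g : Matrix (Fin n) (Fin n) F))ᵀ)).map ((Matrix.toLin' (γ : Matrix (Fin n) (Fin n) F)).restrictScalars 𝒪[F]) =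
          Submodule.span 𝒪[F] (Set.range ((g : Matrix (Fin n) (Fin n) F))ᵀ) ∧
        ∀ i k, valuation F ((((g⁻¹ * γ * g : GL (Fin n) F) : Matrix (Fin n) (Fin n) F) - 1) i k) ≤ valuation F c) ↔
      (Submodule.span 𝒪[F] (Set.range ((g : Matrix (Fin n) (Fin n) F))ᵀ)).map
          ((Matrix.toLin' (1 + c⁻¹ • ((γ : Matrix (Fin n) (Fin n) F) - 1))).restrictScalars 𝒪[F]) ≤
        Submodule.span 𝒪[F] (Set.range ((g : Matrix (Fin n) (Fin n) F))ᵀ) := by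
  rw [map_span_range_transpose_eq_self_iff, mem_glInt_and_level_iff_map_levelShift_le hc hc1]

/-- **LEVEL IMPLIES FIXED** (the «`γL = L` is automatic» clause of the law, on cosets): if `g⁻¹γg − 1` has all entries of valuation `≤ |c| < 1`, then `γ` fixes the coset
`gK`, `K = GL_n(𝒪)`. [cite: Kottwitz1986, §3] -/
theorem smul_mk_eq_of_level {c : F} (hc1 : valuation F c < 1) (γ g : GL (Fin n) F)
    (hlev : ∀ i k, valuation F ((((g⁻¹ * γ * g : GL (Fin n) F) : Matrix (Fin n) (Fin n) F) - 1) i k) ≤ valuation F c) :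
    γ • ((g : GL (Fin n) F) : GL (Fin n) F ⧸ glInt n F) = g :=
  (smul_mk_eq_mk_iff_inv_conj_mem (glInt n F) γ g).2 (mem_glInt_of_forall_valuation_sub_one_lt_one _ fun i k => (hlev i k).trans_lt hc1)

end Literature.NumberTheory.Automorphic

end
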